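import Mathlib.Order.LiminfLimsup
import Literature.MathematicalPhysics.QuantumLattice.FinDimSpectrum
import Literature.MathematicalPhysics.QuantumLattice.HubbardModel
import Literature.MathematicalPhysics.QuantumLattice.PairCorrelations
import HarnessLib

/-!
# The `d`-wave symmetry-breaking source and the `d`-wave order parameter (Hubbard, 2D torus)

Trunk T-QLATTICE (Literature/MathematicalPhysics/QuantumLattice); definition request
`defn-Literature.QLattice.dWaveOrderParameter` (route HubbardSuperconductivity/WeakCouplingBCS,
cruxes #2 and #4). The requester's target hint was
`Summits/HubbardSuperconductivity/Theorems/OrderParameter/DWaveSource.lean`; the notion is a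
generic Koma–Tasaki order parameter and is filed here as Literature (a librarian may re-home it).

Koma–Tasaki (1994, §1) define the order parameter of an order operator `O_Λ` that does not
commute with the Hamiltonian by adding the symmetry-breaking source `-h O_Λ` (here, for the
non-Hermitian pair field, `-h (Δ + Δ†)`), taking the ground-state (or Gibbs) expectation density
`|Λ|⁻¹ ω_{Λ,h}(O_Λ)`, and letting FIRST `Λ ↑ ℤ^d`, THEN `h ↓ 0`. Applied to the `d_{x²-y²}` pair
field `Δ_d = pairField dWaveFormFactor L` of the grand-canonical Hubbard model
`hubbardTorusWith 2 L 1 U μ` on `(ℤ/Lℤ)²` this gives the `d`-wave (superconducting) order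
parameter; the source breaks the `U(1)` particle-number symmetry, which is why the
grand-canonical Hamiltonian (chemical potential `μ`) is used.

## Contents

* `dWaveSourceTorus L U μ h = H(1, U) - μ N - h (Δ_d + Δ_d†)` on the torus of side `L`.
* `dWaveSourceDensity L U μ h = Re ω₀^{L,h}(Δ_d) / L²`, `ω₀` the tracial ground-state functional
  `Matrix.groundStateFunctional` (uniform mixture of ground states — no choice of ground state).
* `dWaveOrderParameter U μ = liminf_{h → 0⁺} liminf_{L → ∞} dWaveSourceDensity (L+1) U μ h`.
* `HasDWaveOrder U μ : Prop := 0 < dWaveOrderParameter U μ`.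

## Sources

* T. Koma, H. Tasaki, *Symmetry breaking and finite-size effects in quantum many-body systems*,
  J. Stat. Phys. 76 (1994) 745–803, §1 (order parameters via an infinitesimal symmetry-breaking
  field, order of limits; the Hubbard model with superconducting ODLRO named as an example).
* H. Tasaki, *The Hubbard model — an introduction and selected rigorous results*,
  J. Phys. Cond. Mat. 10 (1998) 4353, §6 (superconductivity and symmetry breaking in the Hubbard
  model).
* D. J. Scalapino, Phys. Rep. 250 (1995) 329, §2 (the `d_{x²-y²}` pair field).

## Design choices

* `liminf`s (real-valued, Mathlib `Filter.liminf`) rather than limits, as requested: the order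
  parameter is then defined unconditionally; `HasDWaveOrder` asserts it is positive. Mathlib's
  real `liminf` returns the junk value `sSup ∅ = 0`-style defaults when the family is unbounded
  below / not cobounded; `|Re ω(Δ_d)|/L² ≤ ‖Δ_d‖/L² = O(1)`, so on ground-state functionals the
  inner family is bounded (not proved here).
* Index shift `L + 1` (so `NeZero`) inside the `liminf` over `L : ℕ`, as in
  `hasPairFieldLRO_iff_liminf`.
* Only the grand-canonical (fixed `μ`) version is defined; a canonical-doping variant would
  compose with a map `δ ↦ μ(δ)` and is left to the route.
* Normalisation: `Re ω(Δ_d) = ½ ω(Δ_d + Δ_d†) = ½ ω(O_Λ)`, so `dWaveOrderParameter` is HALF of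
  Koma–Tasaki's order parameter for the Hermitian order operator `O_Λ = Δ_d + Δ_d†` (positivity,
  hence `HasDWaveOrder`, is unaffected).
* `HasDWaveOrder U μ` is NOT the notion of `Summits/HubbardSuperconductivity/Statement.lean`
  (`HasPairFieldLRO dWaveFormFactor …`, a long-range-order statement for sector ground states at
  fixed doping); relating symmetry breaking under an infinitesimal source to LRO (Koma–Tasaki-type
  inequalities) is route work, and no fact in this file asserts `HasDWaveOrder` for any `(U, μ)`.
-/

noncomputable section

namespace Literature.MathematicalPhysics.QuantumLattice

open Matrix Finset Filter Literature.Probability.LatticeModels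
open scoped ComplexOrder Topology

section Torus

variable (L : ℕ) [NeZero L]

/-- The grand-canonical Hubbard Hamiltonian on the torus `(ℤ/Lℤ)²` (hopping `t = 1`) with a
`d`-wave pair source of strength `h`:
`H_{L,h} = H(1, U) - μ N - h (Δ_d + Δ_d†)`, `Δ_d = pairField dWaveFormFactor L`. The source is
Hermitian and breaks particle-number conservation. [Koma–Tasaki 1994, §1 (Hamiltonian with
symmetry-breaking field `H_Λ - h O_Λ`); Tasaki 1998, §6] [cite: KomaTasaki1994, §1] -/
def dWaveSourceTorus (U μ h : ℝ) :
    Matrix (Finset (Orb (FermionTorus 2 L))) (Finset (Orb (FermionTorus 2 L))) ℂ :=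
  hubbardTorusWith 2 L 1 U μ -
    (h : ℂ) • (pairField dWaveFormFactor L + (pairField dWaveFormFactor L)ᴴ)

/-- The finite-volume `d`-wave order-parameter density in the source `h`:
`m_L(h) = Re ω₀^{L,h}(Δ_d) / |Λ_L|`, `|Λ_L| = L²`, where `ω₀^{L,h}` is the (tracial) ground-state
functional of `dWaveSourceTorus L U μ h`. [Koma–Tasaki 1994, §1 (`|Λ|⁻¹ ω(O_Λ)`)] [cite: KomaTasaki1994, §1] -/
def dWaveSourceDensity (U μ h : ℝ) : ℝ :=
  ((dWaveSourceTorus L U μ h).groundStateFunctional (pairField dWaveFormFactor L)).re /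
    (L : ℝ) ^ 2

end Torus

/-- The `d`-wave order parameter of the two-dimensional Hubbard model at interaction `U` and
chemical potential `μ` (hopping `1`), à la Koma–Tasaki:
`m_d(U, μ) = liminf_{h → 0⁺} liminf_{L → ∞} Re ω₀^{L,h}(Δ_d) / L²` — thermodynamic limit FIRST,
then the source `h ↓ 0`. [Koma–Tasaki 1994, §1 (order parameter `lim_{h↓0} lim_{Λ↑ℤ^d}`);
Tasaki 1998, §6] [cite: KomaTasaki1994, §1] -/
def dWaveOrderParameter (U μ : ℝ) : ℝ :=
  liminf (fun h : ℝ => liminf (fun L : ℕ => dWaveSourceDensity (L + 1) U μ h) atTop) (𝓝[>] 0)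

/-- `HasDWaveOrder U μ`: the `d`-wave order parameter is strictly positive (spontaneous breaking
of the `U(1)` symmetry with `d_{x²-y²}` pairing, in the Koma–Tasaki sense).
[Koma–Tasaki 1994, §1; Tasaki 1998, §6] [cite: KomaTasaki1994, §1] -/
def HasDWaveOrder (U μ : ℝ) : Prop :=
  0 < dWaveOrderParameter U μ

/-! ### API -/

section API

variable (L : ℕ) [NeZero L]

/-- Without source the Hamiltonian is the grand-canonical Hubbard Hamiltonian.
[Koma–Tasaki 1994, §1] [folklore] -/
@[simp] theorem dWaveSourceTorus_zero (U μ : ℝ) :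
    dWaveSourceTorus L U μ 0 = hubbardTorusWith 2 L 1 U μ := by
  simp [dWaveSourceTorus]

/-- The source term `Δ_d + Δ_d†` is Hermitian. [Koma–Tasaki 1994, §1] [folklore] -/
theorem isHermitian_pairField_add_conjTranspose :
    (pairField dWaveFormFactor L + (pairField dWaveFormFactor L)ᴴ).IsHermitian :=
  isHermitian_add_transpose_self _

/-- The Hamiltonian with `d`-wave source is Hermitian, in witness form: given Hermiticity of the
grand-canonical Hubbard Hamiltonian (the tree's `hubbardTorusWith_isHermitian`, to be supplied by
the caller), `H - h (Δ_d + Δ_d†)` is Hermitian since `h` is real. [Koma–Tasaki 1994, §1] [folklore] -/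
theorem dWaveSourceTorus_isHermitian {U μ : ℝ} (hH : (hubbardTorusWith 2 L 1 U μ).IsHermitian)
    (h : ℝ) :
    (dWaveSourceTorus L U μ h).IsHermitian := by
  unfold dWaveSourceTorus
  refine hH.sub (IsHermitian.smul (isHermitian_pairField_add_conjTranspose L) ?_)
  rw [isSelfAdjoint_iff, Complex.star_def, Complex.conj_ofReal]

/-- Unfolding the order parameter. [Koma–Tasaki 1994, §1] [folklore] -/
theorem dWaveOrderParameter_eq (U μ : ℝ) :
    dWaveOrderParameter U μ =
      liminf (fun h : ℝ => liminf (fun L : ℕ =>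
        ((dWaveSourceTorus (L + 1) U μ h).groundStateFunctional
            (pairField dWaveFormFactor (L + 1))).re / ((L + 1 : ℕ) : ℝ) ^ 2) atTop) (𝓝[>] 0) :=
  rfl

/-- Unfolding `HasDWaveOrder`. [Koma–Tasaki 1994, §1] [folklore] -/
theorem hasDWaveOrder_iff (U μ : ℝ) : HasDWaveOrder U μ ↔ 0 < dWaveOrderParameter U μ :=
  Iff.rfl

end API

end Literature.MathematicalPhysics.QuantumLattice
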